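import Literature.Probability.RandomPlanarGeometry.HexSAWBrickWallStripFugacityWidthOneContactGaussianMGF
import HarnessLib

/-!
# Gaussian tail bounds at the central-limit scale for the contact number, and the top-wall mgf

Topic `Literature/Probability/RandomPlanarGeometry` (continues `HexSAWBrickWallStripFugacityWidthOneContactGaussianMGF.lean`: for all `y, z > 0` and every
real `s`, `M_N(s) := C_{1,N}(y e^{s/√N}, z)/C_{1,N}(y,z) · e^{−s√N b} → e^{σ²s²/2}`, `σ² = d/dA b(e^A,z)|_{A = log y} > 0`).
THIS FILE draws the sharp-constant consequences that do not need a continuity theorem for moment generating functions: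

* §1 ★★★ `tendsto_topContactMGF_gaussian` — the TOP wall: `C_{1,N}(y, z e^{s/√N})/C_{1,N}(y,z) · e^{−s√N b(z,y)} → e^{σ_top² s²/2}`,
  `σ_top² = d/dB b(e^B, y)|_{B = log z}` (reflection `stripZ₂_symm`).
* §2 ★★★ `eventually_contactUpperTail_le` / ★★★ `eventually_contactLowerTail_le`: for every `x > 0` and `ε > 0`, for all large `N`,
  `P_{N,y,z}(bc ≥ N b + x√N) ≤ e^{−x²/(2σ²)} + ε` and `P_{N,y,z}(bc ≤ N b − x√N) ≤ e^{−x²/(2σ²)} + ε` — GAUSSIAN TAILS AT THE CLT SCALE WITH THE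
  SHARP VARIANCE CONSTANT (exponential Chebyshev at the optimal tilt `s = ±x/σ²` + the mgf limit); ★★ `eventually_contactTwoSidedTail_le`
  (`P_{N,y,z}(|bc − N b| ≥ x√N) ≤ 2e^{−x²/(2σ²)} + ε`).

Numerics (`tail_check.py`, exact bivariate series): `(2,1)`, `σ² = 0.1859`, `x = 1`: `P_N(bc ≥ Nb + √N) = 0.0081/0.0106/0.0087` and
`P_N(bc ≤ Nb − √N) = 0.0103/0.0100/0.0113` (`N = 100/200/400`) — the Gaussian tail `P(Z ≥ 1) = 0.0102` — below the bound `e^{−1/(2σ²)} = 0.0679`;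
`x = 1/2`: `0.113/0.127/0.114` vs Gaussian `0.1231`, bound `0.511`.  `(1,1)`: `x = 1`: `0.0066/0.0051/0.0048` (Gaussian `0.0038`, bound `0.0285`).

## Sources
A. Dembo, O. Zeitouni, *Large Deviations Techniques and Applications* (2010) §2.3 (exponential Chebyshev inequality / upper bound of Gärtner–Ellis;
lane statements); N. Madras, G. Slade (1993) §1.1; N. R. Beaton et al., CMP 326 (2014), arXiv:1109.0358v5 §3.2 Proposition 6 (p. 10; symmetry
clause for §1).  Nothing is quoted AS PRINTED; statements and constants are this lineage's.
-/

noncomputable section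

open Filter Topology Finset Set Literature.Analysis
open Literature.Probability.LatticeModels Literature.Probability.Percolation

namespace Literature.Probability.RandomPlanarGeometry.SAW.HexBW

namespace WidthOneYZ

variable {y z : ℝ}

/-! ## §1 The top wall -/

/-- ★★★ **GAUSSIAN MGF OF THE TOP CONTACT NUMBER**: for all `y, z > 0` and every real `s`,
`C_{1,N}(y, z e^{s/√N})/C_{1,N}(y,z) · e^{−s√N·b(z,y)} → exp(σ_top² s²/2)`, `σ_top² = d/dB b(e^B, y)|_{B = log z}` — the bottom-wall theorem
`tendsto_contactMGF_gaussian` with the fugacities exchanged (`stripZ₂_symm`).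
[cite: DemboZeitouni2010, §2.3 (lane statement); BeatonBousquetMelouDeGierDuminilCopinGuttmann2014, §3.2 Proposition 6 (arXiv v5 p. 10: symmetry); MadrasSlade1993, §1.1 eq. (1.1.4) p. 5] -/
theorem tendsto_topContactMGF_gaussian (hy : 0 < y) (hz : 0 < z) (s : ℝ) :
    Tendsto (fun N : ℕ => stripZ₂ 1 N y (z * Real.exp (s / Real.sqrt N)) / stripZ₂ 1 N y z
        * Real.exp (-(s * Real.sqrt N * contactB z y))) atTop
      (𝓝 (Real.exp (deriv (fun B => contactB (Real.exp B) y) (Real.log z) * s ^ 2 / 2))) := by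
  have h := tendsto_contactMGF_gaussian hz hy s
  refine h.congr fun N => ?_
  rw [stripZ₂_symm 1 N (z * Real.exp (s / Real.sqrt N)) y, stripZ₂_symm 1 N z y]

/-! ## §2 Gaussian tails at the scale `√N` -/

/-- The variance rate is positive: `0 < d/dA b(e^A, z)|_{A = log y}` (tree: `hasDerivAt_contactB_log`). [cite: DemboZeitouni2010, §2.3 (lane statement)] -/
theorem deriv_contactB_exp_pos (hy : 0 < y) (hz : 0 < z) : 0 < deriv (fun A => contactB (Real.exp A) z) (Real.log y) := by
  have h := hasDerivAt_contactB_log (Real.log y) (Real.log z)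
  simp only [Real.exp_log hy, Real.exp_log hz] at h
  obtain ⟨-, -, dA, -, -, hpos, -⟩ := h
  rw [dA.deriv]
  exact hpos

open Classical in
/-- ★★★ **GAUSSIAN UPPER TAIL AT THE CLT SCALE, SHARP CONSTANT**: for all `y, z > 0`, `x > 0` and `ε > 0`, for all large `N`,
`P_{N,y,z}(bc ≥ N·b(y,z) + x√N) ≤ exp(−x²/(2σ²)) + ε`, `σ² = d/dA b(e^A,z)|_{log y}` — exponential Chebyshev at the tilt `u = e^{s/√N}`, `s = x/σ²`
(`sum_contacts_ge_mul_rpow_le`), and `e^{−sx} M_N(s) → e^{−sx + σ²s²/2} = e^{−x²/(2σ²)}` (`tendsto_contactMGF_gaussian`).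
[cite: DemboZeitouni2010, §2.3 (exponential Chebyshev / Gärtner–Ellis upper bound; lane statement); MadrasSlade1993, §1.1] -/
theorem eventually_contactUpperTail_le (hy : 0 < y) (hz : 0 < z) {x : ℝ} (hx : 0 < x) {ε : ℝ} (hε : 0 < ε) :
    ∀ᶠ N : ℕ in atTop,
      (∑ q ∈ (stripPairs 1 N).filter (fun q => (N : ℝ) * contactB y z + x * Real.sqrt N ≤ (bottomVisits₀ q.1 q.2 N : ℝ)), wgt y z N q)
          / stripZ₂ 1 N y z
        ≤ Real.exp (-(x ^ 2 / (2 * deriv (fun A => contactB (Real.exp A) z) (Real.log y)))) + ε := by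
  set σ2 := deriv (fun A => contactB (Real.exp A) z) (Real.log y) with hσ2
  set b := contactB y z with hb
  have hσ : 0 < σ2 := deriv_contactB_exp_pos hy hz
  set s := x / σ2 with hs
  have hs0 : 0 < s := div_pos hx hσ
  -- the mgf limit at the optimal tilt, multiplied by `e^{−sx}`
  have hM := (tendsto_contactMGF_gaussian hy hz s).mul_const (Real.exp (-(s * x)))
  have hlim : Real.exp (σ2 * s ^ 2 / 2) * Real.exp (-(s * x)) = Real.exp (-(x ^ 2 / (2 * σ2))) := by
    rw [← Real.exp_add]; congr 1; rw [hs]; field_simp; ring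
  rw [hlim] at hM
  have hev := (Metric.tendsto_atTop.1 hM) ε hε
  obtain ⟨N₀, hN₀⟩ := hev
  filter_upwards [eventually_ge_atTop (max N₀ 1)] with N hN
  have hN1 : 1 ≤ N := le_trans (le_max_right _ _) hN
  have hNr : (0 : ℝ) < N := by exact_mod_cast hN1
  have hsq : 0 < Real.sqrt (N : ℝ) := Real.sqrt_pos.2 hNr
  -- Chernoff with `u = e^{s/√N} ≥ 1` and `κN = N b + x√N`
  set u := Real.exp (s / Real.sqrt N) with hu
  have hu1 : 1 ≤ u := Real.one_le_exp (div_pos hs0 hsq).le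
  have hupos : 0 < u := Real.exp_pos _
  set κ := ((N : ℝ) * b + x * Real.sqrt N) / N with hκ
  have hκN : κ * N = (N : ℝ) * b + x * Real.sqrt N := by rw [hκ]; field_simp
  have hcher := sum_contacts_ge_mul_rpow_le hy.le hz.le hu1 N κ
  rw [hκN] at hcher
  have hZ := stripZ₂_pos 1 N hy hz
  have hupow : 0 < u ^ ((N : ℝ) * b + x * Real.sqrt N) := Real.rpow_pos_of_pos hupos _
  -- the tail fraction is at most `M_N(s) e^{−sx}`
  have hkey : (∑ q ∈ (stripPairs 1 N).filter (fun q => (N : ℝ) * b + x * Real.sqrt N ≤ (bottomVisits₀ q.1 q.2 N : ℝ)), wgt y z N q)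
        / stripZ₂ 1 N y z
      ≤ stripZ₂ 1 N (y * Real.exp (s / Real.sqrt N)) z / stripZ₂ 1 N y z * Real.exp (-(s * Real.sqrt N * b)) * Real.exp (-(s * x)) := by
    have e1 : u ^ ((N : ℝ) * b + x * Real.sqrt N) = Real.exp (s * Real.sqrt N * b) * Real.exp (s * x) := by
      rw [hu, ← Real.exp_mul, ← Real.exp_add]
      congr 1
      rw [div_mul_eq_mul_div, div_eq_iff hsq.ne']
      linear_combination (-(s * b)) * Real.mul_self_sqrt hNr.le
    have h1 : (∑ q ∈ (stripPairs 1 N).filter (fun q => (N : ℝ) * b + x * Real.sqrt N ≤ (bottomVisits₀ q.1 q.2 N : ℝ)), wgt y z N q)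
        ≤ stripZ₂ 1 N (y * u) z / u ^ ((N : ℝ) * b + x * Real.sqrt N) := by
      rw [le_div_iff₀ hupow]; exact hcher
    calc _ ≤ stripZ₂ 1 N (y * u) z / u ^ ((N : ℝ) * b + x * Real.sqrt N) / stripZ₂ 1 N y z :=
          div_le_div_of_nonneg_right h1 hZ.le
      _ = _ := by
          rw [e1, hu, Real.exp_neg, Real.exp_neg]
          field_simp
  refine le_trans hkey ?_
  have := hN₀ N (le_trans (le_max_left _ _) hN)
  rw [Real.dist_eq] at this
  linarith [(abs_lt.1 this).2]

open Classical in
/-- ★★★ **GAUSSIAN LOWER TAIL AT THE CLT SCALE, SHARP CONSTANT**: for all `y, z > 0`, `x > 0` and `ε > 0`, for all large `N`,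
`P_{N,y,z}(bc ≤ N·b(y,z) − x√N) ≤ exp(−x²/(2σ²)) + ε` (tilt `u = e^{−s/√N} ≤ 1`, `s = x/σ²`, `sum_contacts_le_mul_rpow_le`, and the mgf limit at `−s`).
[cite: DemboZeitouni2010, §2.3 (exponential Chebyshev / Gärtner–Ellis upper bound; lane statement); MadrasSlade1993, §1.1] -/
theorem eventually_contactLowerTail_le (hy : 0 < y) (hz : 0 < z) {x : ℝ} (hx : 0 < x) {ε : ℝ} (hε : 0 < ε) :
    ∀ᶠ N : ℕ in atTop,
      (∑ q ∈ (stripPairs 1 N).filter (fun q => (bottomVisits₀ q.1 q.2 N : ℝ) ≤ (N : ℝ) * contactB y z - x * Real.sqrt N), wgt y z N q)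
          / stripZ₂ 1 N y z
        ≤ Real.exp (-(x ^ 2 / (2 * deriv (fun A => contactB (Real.exp A) z) (Real.log y)))) + ε := by
  set σ2 := deriv (fun A => contactB (Real.exp A) z) (Real.log y) with hσ2
  set b := contactB y z with hb
  have hσ : 0 < σ2 := deriv_contactB_exp_pos hy hz
  set s := x / σ2 with hs
  have hs0 : 0 < s := div_pos hx hσ
  have hM := (tendsto_contactMGF_gaussian hy hz (-s)).mul_const (Real.exp (-(s * x)))
  have hlim : Real.exp (σ2 * (-s) ^ 2 / 2) * Real.exp (-(s * x)) = Real.exp (-(x ^ 2 / (2 * σ2))) := by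
    rw [← Real.exp_add]; congr 1; rw [hs]; field_simp; ring
  rw [hlim] at hM
  obtain ⟨N₀, hN₀⟩ := (Metric.tendsto_atTop.1 hM) ε hε
  filter_upwards [eventually_ge_atTop (max N₀ 1)] with N hN
  have hN1 : 1 ≤ N := le_trans (le_max_right _ _) hN
  have hNr : (0 : ℝ) < N := by exact_mod_cast hN1
  have hsq : 0 < Real.sqrt (N : ℝ) := Real.sqrt_pos.2 hNr
  set u := Real.exp (-s / Real.sqrt N) with hu
  have hupos : 0 < u := Real.exp_pos _
  have hu1 : u ≤ 1 := by
    rw [hu]; apply Real.exp_le_one_iff.2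
    exact div_nonpos_of_nonpos_of_nonneg (by linarith) hsq.le
  set κ := ((N : ℝ) * b - x * Real.sqrt N) / N with hκ
  have hκN : κ * N = (N : ℝ) * b - x * Real.sqrt N := by rw [hκ]; field_simp
  have hcher := sum_contacts_le_mul_rpow_le hy.le hz.le hupos hu1 N κ
  rw [hκN] at hcher
  have hZ := stripZ₂_pos 1 N hy hz
  have hupow : 0 < u ^ ((N : ℝ) * b - x * Real.sqrt N) := Real.rpow_pos_of_pos hupos _
  have hkey : (∑ q ∈ (stripPairs 1 N).filter (fun q => (bottomVisits₀ q.1 q.2 N : ℝ) ≤ (N : ℝ) * b - x * Real.sqrt N), wgt y z N q)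
        / stripZ₂ 1 N y z
      ≤ stripZ₂ 1 N (y * Real.exp (-s / Real.sqrt N)) z / stripZ₂ 1 N y z * Real.exp (-(-s * Real.sqrt N * b)) * Real.exp (-(s * x)) := by
    have e1 : u ^ ((N : ℝ) * b - x * Real.sqrt N) = Real.exp (-(s * Real.sqrt N * b)) * Real.exp (s * x) := by
      rw [hu, ← Real.exp_mul, ← Real.exp_add]
      congr 1
      rw [div_mul_eq_mul_div, div_eq_iff hsq.ne']
      linear_combination (s * b) * Real.mul_self_sqrt hNr.le
    have h1 : (∑ q ∈ (stripPairs 1 N).filter (fun q => (bottomVisits₀ q.1 q.2 N : ℝ) ≤ (N : ℝ) * b - x * Real.sqrt N), wgt y z N q)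
        ≤ stripZ₂ 1 N (y * u) z / u ^ ((N : ℝ) * b - x * Real.sqrt N) := by
      rw [le_div_iff₀ hupow]; exact hcher
    calc _ ≤ stripZ₂ 1 N (y * u) z / u ^ ((N : ℝ) * b - x * Real.sqrt N) / stripZ₂ 1 N y z :=
          div_le_div_of_nonneg_right h1 hZ.le
      _ = _ := by
          have x1 : Real.exp (-(-s * Real.sqrt N * b)) = Real.exp (s * Real.sqrt N * b) := by congr 1; ring
          have x2 : Real.exp (-(s * Real.sqrt N * b)) = (Real.exp (s * Real.sqrt N * b))⁻¹ := Real.exp_neg _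
          have x3 : Real.exp (-(s * x)) = (Real.exp (s * x))⁻¹ := Real.exp_neg _
          rw [e1, x1, x2, x3, hu]
          field_simp
  refine le_trans hkey ?_
  have := hN₀ N (le_trans (le_max_left _ _) hN)
  rw [Real.dist_eq] at this
  linarith [(abs_lt.1 this).2]

open Classical in
/-- ★★ **TWO-SIDED GAUSSIAN TAIL AT THE CLT SCALE**: for all `y, z > 0`, `x > 0`, `ε > 0` and all large `N`,
`P_{N,y,z}(|bc − N·b| ≥ x√N) ≤ 2·exp(−x²/(2σ²)) + ε`. [cite: DemboZeitouni2010, §2.3 (lane statement); MadrasSlade1993, §1.1] -/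
theorem eventually_contactTwoSidedTail_le (hy : 0 < y) (hz : 0 < z) {x : ℝ} (hx : 0 < x) {ε : ℝ} (hε : 0 < ε) :
    ∀ᶠ N : ℕ in atTop,
      (∑ q ∈ (stripPairs 1 N).filter (fun q => x * Real.sqrt N ≤ |(bottomVisits₀ q.1 q.2 N : ℝ) - (N : ℝ) * contactB y z|), wgt y z N q)
          / stripZ₂ 1 N y z
        ≤ 2 * Real.exp (-(x ^ 2 / (2 * deriv (fun A => contactB (Real.exp A) z) (Real.log y)))) + ε := by
  have h1 := eventually_contactUpperTail_le hy hz hx (half_pos hε)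
  have h2 := eventually_contactLowerTail_le hy hz hx (half_pos hε)
  filter_upwards [h1, h2] with N hU hL
  have hZ := stripZ₂_pos 1 N hy hz
  have hsplit : (∑ q ∈ (stripPairs 1 N).filter (fun q => x * Real.sqrt N ≤ |(bottomVisits₀ q.1 q.2 N : ℝ) - (N : ℝ) * contactB y z|), wgt y z N q)
      ≤ (∑ q ∈ (stripPairs 1 N).filter (fun q => (N : ℝ) * contactB y z + x * Real.sqrt N ≤ (bottomVisits₀ q.1 q.2 N : ℝ)), wgt y z N q)
        + (∑ q ∈ (stripPairs 1 N).filter (fun q => (bottomVisits₀ q.1 q.2 N : ℝ) ≤ (N : ℝ) * contactB y z - x * Real.sqrt N), wgt y z N q) := by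
    rw [← Finset.sum_union_inter]
    have hnn : 0 ≤ ∑ q ∈ (stripPairs 1 N).filter (fun q => (N : ℝ) * contactB y z + x * Real.sqrt N ≤ (bottomVisits₀ q.1 q.2 N : ℝ)) ∩
        (stripPairs 1 N).filter (fun q => (bottomVisits₀ q.1 q.2 N : ℝ) ≤ (N : ℝ) * contactB y z - x * Real.sqrt N), wgt y z N q :=
      Finset.sum_nonneg fun q _ => (wgt_pos hy hz N q).le
    refine le_trans ?_ (le_add_of_nonneg_right hnn)
    refine Finset.sum_le_sum_of_subset_of_nonneg (fun q hq => ?_) (fun q _ _ => (wgt_pos hy hz N q).le)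
    rw [Finset.mem_filter] at hq
    rw [Finset.mem_union, Finset.mem_filter, Finset.mem_filter]
    rcases le_abs'.1 hq.2 with h | h
    · exact Or.inr ⟨hq.1, by linarith⟩
    · exact Or.inl ⟨hq.1, by linarith⟩
  calc _ ≤ ((∑ q ∈ (stripPairs 1 N).filter (fun q => (N : ℝ) * contactB y z + x * Real.sqrt N ≤ (bottomVisits₀ q.1 q.2 N : ℝ)), wgt y z N q)
        + (∑ q ∈ (stripPairs 1 N).filter (fun q => (bottomVisits₀ q.1 q.2 N : ℝ) ≤ (N : ℝ) * contactB y z - x * Real.sqrt N), wgt y z N q))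
          / stripZ₂ 1 N y z := div_le_div_of_nonneg_right hsplit hZ.le
    _ = _ + _ := add_div _ _ _
    _ ≤ _ := by linarith

end WidthOneYZ

end Literature.Probability.RandomPlanarGeometry.SAW.HexBW
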